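import Summits.BirchSwinnertonDyer.BirchSwinnertonDyer.Theorems.ByReductionTypeAtTwoTowerCorankBoundOfFaithfulParts
import Literature.NumberTheory.EllipticCurves.KatoTwistedFiniteness
import Mathlib.RingTheory.Polynomial.Cyclotomic.Roots
import HarnessLib

/-!
# Route `ByReductionTypeAtTwo` (rung K4), crux `SupersingularRankZeroAtTwo` (item stmt-BirchSwinnertonDyer-19097), slot 4a
# `stub_classicalNF` (h11): the FAITHFUL part `ker Φ_{p^{k+1}}(γ)` of `Sel_{p^∞}(E/K_{k+1})` IS Kato's `χ`-part `M^{(χ)}`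
# for every faithful character `χ` of `Gal(K_{k+1}/K)` — kernel glue (D) of the pen's BRIEF-hKR / RC-765, so that Kato's
# Cor. 14.3 (1) typed VERBATIM in Kato's own `chiPart` vocabulary (G1b) feeds the tower corank bound (C) of
# `…TowerCorankBoundOfFaithfulParts` BY NAME

HONEST FRAMING (cell `bsd-2adic`, run/shared/lean/pub/bsd-2adic/, seat `bsd-2adic-ss-1` GEN 24 = LEAD lineage of 19097;
HUMAN RULINGS D-0036 / D-0054 / D-0074): THEOREMS ONLY (no definition, no named fact, no instance, no `sorry`, axioms the
standard trio); PURE ALGEBRA; ANY number field `K`, ANY prime `p`, ANY `ℤ_p`-extension `κ` with topological generator `γ`,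
ANY character `χ` with values in a field of characteristic `0`.  Closes no route item; nothing booked; BSD is not proved by any
of this.

## What is proved

§1 (abstract).  `G`, `M` arbitrary, `ρ : G → (M →+ M)`, `χ : G → R` into a field of characteristic zero, `g₀ ∈ G` with
`ζ = χ g₀` a PRIMITIVE `N`-th root of unity, `T` an additive endomorphism of `M`, and every `g ∈ G` valued/acting
as a power (`χ g = ζ^e`, `ρ g = T^e`).  Then Kato's `χ`-part (`chiPart ρ χ = {x | I_χ · x = 0}`, `I_χ = ker(ℤ[G] → R)`,
Astérisque 295 p. 235) CONTAINS the kernel of `Φ_N(T)` (`mem_chiPart_of_aeval_cyclotomic_apply_eq_zero`): an integer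
relation `Σ n_g χ(g) = Σ n_g ζ^{e_g} = 0` makes `Σ n_g X^{e_g}` a multiple of `Φ_N = minpoly_ℤ ζ` (Mathlib
`cyclotomic_eq_minpoly`, `minpoly.isIntegrallyClosed_dvd`), so `Σ n_g ρ(g) x = (Σ n_g X^{e_g})(T) x` dies on `ker Φ_N(T)`.
Conversely (`aeval_cyclotomic_apply_eq_zero_of_mem_chiPart`, `G` a monoid, `ρ`/`χ` multiplicative on powers of `g₀`) the
`χ`-part is killed by `Φ_N(T)` because `Φ_N(g₀) ∈ I_χ`.  So `M^{(χ)} = ker Φ_N(T)` EXACTLY — the same subgroup for ALL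
faithful `χ`.

§2 (the tower).  `G = Γ_K`, `M = H¹(Gal(K̄/K_{k+1}), E[p^∞])` (`W.subgroupH1 p (κ.layerSubgroup (k+1))`), `ρ = conj`
(`W.conjH1`), `g₀ = γ`, `N = p^{k+1}`: every `σ ∈ Γ_K` is `h γ^e` with `h ∈ Gal(K̄/K_{k+1})`
(`exists_mem_layerSubgroup_mul_pow`) and inner automorphisms act trivially (`conjH1_of_mem_holds`), so for a character `χ` of
`Γ_K` trivial on `Gal(K̄/K_{k+1})` with `χ(γ)` a primitive `p^{k+1}`-th root of unity (a FAITHFUL character of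
`Gal(K_{k+1}/K) ≅ ℤ/p^{k+1}`):  `x ∈ chiPart conj χ ↔ Σ_{i<p} conj_{γ^{p^k i}} x = 0`
(`mem_chiPart_conjH1_iff_sum_conjH1_eq_zero`; `Φ_{p^{k+1}}(X) = Σ_{i<p} X^{p^k i}`, Mathlib `cyclotomic_prime_pow_eq_geom_sum`).

§3 (consumable form of (C)).  ★★ `exists_forall_zpCorank_selmerLayer_le_of_eventually_finite_chiPart`: if for all `k ≥ k₀`
some such faithful `χ_k` has `chiPart conj χ_k ⊓ Sel_{p^∞}(E/K_{k+1})` FINITE — the conclusion shape of Kato's Cor. 14.3 (1)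
(`kato_finite_chiPart_selmer_of_twistedLValue_ne_zero`: `Finite (chiPart ρ χ ⊓ Sel)`) — then
`∃ B, ∀ n, zpCorank (W.selmerLayer κ n) p ≤ B` (= the binder `hKR` of ★★ p823354).  What remains for `hKR` at good
supersingular `2` (NOT here): G1b = Kato Cor. 14.3 (1) on the layers `ℚ_n` (a Literature statement), G4 = Rohrlich's theorem
(`Rohrlich1984_nonvanishing_twists_holds`, tree) giving `k₀`, and the character dictionary (`LayerCharacterTwoProofs`).

References: K. Kato, Astérisque 295 (2004), Thm. 14.2 / Cor. 14.3 and the display after Thm. 14.2 (p. 235: `M^{(χ)}`,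
`I_χ`); R. Greenberg, LNM 1716 (1999), §1/§3; L. C. Washington, *Introduction to Cyclotomic Fields*, §13.1 and Ch. 2
(`ℤ[X]/(Φ_N) ≅ ℤ[ζ_N]`); D. Rohrlich, Invent. Math. 75 (1984).
-/

set_option autoImplicit false
-- the Theorems namespace of this sub repeats the summit name by design (D-0017 nested layout: Summit.<S>.<Sub>)
set_option linter.dupNamespace false

noncomputable section

open scoped Classical AddSubgroup Polynomial

universe u

namespace Summit.BirchSwinnertonDyer.BirchSwinnertonDyer.Theorems.TowerCorank

open Field WeierstrassCurve Polynomial Literature.NumberTheory.EllipticCurves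
  Summit.BirchSwinnertonDyer.BirchSwinnertonDyer.Theorems.TowerHaMa

/-! ## §1 Abstract: Kato's `χ`-part for a faithful `χ` is the kernel of `Φ_N(T)` -/

section Abstract

variable {G M R : Type*} [AddCommGroup M] [Field R] [CharZero R]

omit [Field R] [CharZero R] in
/-- Evaluation of the integer polynomial `Σ_{i ∈ s} n_i X^{e_i}` at an additive endomorphism `T`, applied to `x`:
`(Σ n_i X^{e_i})(T) x = Σ n_i T^{e_i} x`. [folklore] -/
theorem aeval_finset_sum_C_mul_X_pow_apply {ι : Type*} (s : Finset ι) (n : ι → ℤ) (e : ι → ℕ)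
    (T : AddMonoid.End M) (x : M) :
    aeval T (∑ i ∈ s, C (n i) * X ^ (e i)) x = ∑ i ∈ s, n i • (T ^ (e i)) x := by
  rw [map_sum, addMonoidEnd_sum_apply]
  refine Finset.sum_congr rfl fun i _ ↦ ?_
  rw [map_mul, aeval_C, map_pow, aeval_X, AddMonoid.End.coe_mul, Function.comp_apply, algebraMap_int_eq, eq_intCast,
    AddMonoid.End.intCast_apply]

omit [CharZero R] in
/-- Evaluation of `Σ_{i ∈ s} n_i X^{e_i}` at a scalar `ζ`: `Σ n_i ζ^{e_i}`. [folklore] -/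
theorem aeval_finset_sum_C_mul_X_pow {ι : Type*} (s : Finset ι) (n : ι → ℤ) (e : ι → ℕ) (ζ : R) :
    aeval ζ (∑ i ∈ s, C (n i) * X ^ (e i)) = ∑ i ∈ s, (n i : R) * ζ ^ (e i) := by
  rw [map_sum]
  refine Finset.sum_congr rfl fun i _ ↦ ?_
  rw [map_mul, aeval_C, map_pow, aeval_X, algebraMap_int_eq, eq_intCast]

/-- ★ **Kato's `χ`-part of a FAITHFUL character contains the kernel of `Φ_N(T)`.** Let `ρ : G → (M →+ M)`, `χ : G → R`
(`R` a field of characteristic `0`), `g₀ ∈ G` with `χ g₀` a primitive `N`-th root of unity, `T` an additive endomorphism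
of `M`, and suppose every `g ∈ G` is valued and acts as a power (`χ g = (χ g₀)^e`, `ρ g = T^e`).  If `Φ_N(T) x = 0` then
`x ∈ M^{(χ)}`: for `a = Σ n_g g ∈ I_χ`, `Σ n_g (χ g₀)^{e_g} = 0` forces `Φ_N = minpoly_ℤ(χ g₀) ∣ Σ n_g X^{e_g}`
(`cyclotomic_eq_minpoly`, `minpoly.isIntegrallyClosed_dvd`), whence `a · x = (Σ n_g X^{e_g})(T) x = 0`.  Kato, Astérisque
295, p. 235 (definition of `M^{(χ)}`); Washington, Ch. 2 (`ℤ[X]/(Φ_N) ≅ ℤ[ζ_N]`).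
[cite: Kato2004Asterisque, §14 Thm. 14.2 (p. 235)] [cite: Washington1997, Ch. 2 (`Φ_n` is the minimal polynomial of `ζ_n` over `ℚ`)] -/
theorem mem_chiPart_of_aeval_cyclotomic_apply_eq_zero (ρ : G → M →+ M) (χ : G → R) (g₀ : G) (T : AddMonoid.End M)
    {N : ℕ} (hN : 0 < N) (hζ : IsPrimitiveRoot (χ g₀) N)
    (hG : ∀ g : G, ∃ e : ℕ, χ g = χ g₀ ^ e ∧ ∀ x : M, ρ g x = (T ^ e) x)
    {x : M} (hx : aeval T (cyclotomic N ℤ) x = 0) :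
    x ∈ chiPart ρ χ := by
  rw [mem_chiPart_iff]
  intro a ha
  choose e he using hG
  -- the integer polynomial `P = Σ n_g X^{e_g}` vanishes at `ζ = χ g₀`
  set P : ℤ[X] := ∑ g ∈ a.support, C (a g) * X ^ (e g) with hP
  have hPζ : aeval (χ g₀) P = 0 := by
    rw [hP, aeval_finset_sum_C_mul_X_pow]
    rw [Finsupp.sum] at ha
    rw [← ha]
    exact Finset.sum_congr rfl fun g _ ↦ by rw [(he g).1]
  -- hence `Φ_N ∣ P` over `ℤ`
  have hdvd : cyclotomic N ℤ ∣ P := by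
    rw [cyclotomic_eq_minpoly hζ hN]
    exact minpoly.isIntegrallyClosed_dvd (hζ.isIntegral hN) hPζ
  obtain ⟨Q, hQ⟩ := hdvd
  -- evaluate at `T`
  have hPT : aeval T P x = a.sum fun g n ↦ n • ρ g x := by
    rw [hP, aeval_finset_sum_C_mul_X_pow_apply, Finsupp.sum]
    exact Finset.sum_congr rfl fun g _ ↦ by rw [(he g).2 x]
  rw [← hPT, hQ, mul_comm, map_mul, AddMonoid.End.coe_mul, Function.comp_apply, hx, map_zero]

omit [CharZero R] in
/-- **Converse: the `χ`-part is killed by `Φ_N(T)`** (for `G` a monoid, `ρ`/`χ` multiplicative on the powers of `g₀`):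
`Φ_N(g₀) = Σ_j c_j g₀^j ∈ I_χ` since `Φ_N(χ g₀) = 0`.  Kato, Astérisque 295, p. 235. [cite: Kato2004Asterisque, §14 Thm. 14.2 (p. 235)] -/
theorem aeval_cyclotomic_apply_eq_zero_of_mem_chiPart [Monoid G] (ρ : G → M →+ M) (χ : G → R) (g₀ : G)
    (T : AddMonoid.End M) {N : ℕ} (hN : 0 < N) (hζ : IsPrimitiveRoot (χ g₀) N)
    (hχ : ∀ j : ℕ, χ (g₀ ^ j) = χ g₀ ^ j) (hρ : ∀ (j : ℕ) (x : M), ρ (g₀ ^ j) x = (T ^ j) x)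
    {x : M} (hx : x ∈ chiPart ρ χ) :
    aeval T (cyclotomic N ℤ) x = 0 := by
  rw [mem_chiPart_iff] at hx
  -- `a := Σ_j coeff_j (Φ_N) · [g₀^j] ∈ ℤ[G]`
  set a : G →₀ ℤ := ∑ j ∈ Finset.range ((cyclotomic N ℤ).natDegree + 1), Finsupp.single (g₀ ^ j) ((cyclotomic N ℤ).coeff j) with ha_def
  have haχ : (a.sum fun g n ↦ (n : R) * χ g) = ∑ j ∈ Finset.range ((cyclotomic N ℤ).natDegree + 1), ((cyclotomic N ℤ).coeff j : R) * χ (g₀ ^ j) := by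
    rw [ha_def, ← Finsupp.sum_finsetSum_index (h := fun g (n : ℤ) ↦ (n : R) * χ g) (fun g ↦ by simp)
      (fun g m n ↦ by push_cast; ring)]
    exact Finset.sum_congr rfl fun j _ ↦ Finsupp.sum_single_index (by simp)
  have haρ : (a.sum fun g n ↦ n • ρ g x) = ∑ j ∈ Finset.range ((cyclotomic N ℤ).natDegree + 1), (cyclotomic N ℤ).coeff j • ρ (g₀ ^ j) x := by
    rw [ha_def, ← Finsupp.sum_finsetSum_index (h := fun g (n : ℤ) ↦ n • ρ g x) (fun g ↦ zero_smul ℤ _)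
      (fun g m n ↦ add_smul m n _)]
    exact Finset.sum_congr rfl fun j _ ↦ Finsupp.sum_single_index (zero_smul ℤ _)
  have ha : (a.sum fun g n ↦ (n : R) * χ g) = 0 := by
    have hroot : aeval (χ g₀) (cyclotomic N ℤ) = 0 := by
      simpa [aeval_def, eval₂_eq_eval_map, IsRoot.def] using hζ.isRoot_cyclotomic hN
    rw [aeval_eq_sum_range] at hroot
    rw [haχ, ← hroot]
    refine Finset.sum_congr rfl fun j _ ↦ ?_
    rw [hχ j, zsmul_eq_mul]
  have h := hx a ha
  rw [haρ] at h
  rw [aeval_eq_sum_range, addMonoidEnd_sum_apply, ← h]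
  refine Finset.sum_congr rfl fun j _ ↦ ?_
  rw [hρ j x, Algebra.smul_def, algebraMap_int_eq, eq_intCast, AddMonoid.End.coe_mul, Function.comp_apply,
    AddMonoid.End.intCast_apply]

end Abstract

/-! ## §2 The tower: `x ∈ chiPart conj χ ↔ Σ_{i<p} conj_{γ^{p^k i}} x = 0` for a faithful `χ` of `Gal(K_{k+1}/K)` -/

section Tower

variable {K : Type u} [Field K] [NumberField K] (W : WeierstrassCurve K) [W.IsElliptic] (p : ℕ) [hp : Fact p.Prime]
  (κ : ZpExtension K p) {γ : Field.absoluteGaloisGroup K} {R : Type*} [Field R] [CharZero R]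

omit [NumberField K] in
/-- **`Γ_K = ⋃_e Gal(K̄/K_m) γ^e`**: every `σ ∈ Γ_K` is `h γ^e` with `h ∈ Gal(K̄/K_m)` (`κ σ ≡ e mod p^m`, `e = appr`).
Universe-polymorphic form of the tree's `ZpExtension.exists_layerSubgroup_mul_pow` (stated there for `K : Type`).
Washington, §13.1. [cite: Washington1997, §13.1 (`Gal(K_n/K) ≃ ℤ/pⁿℤ`, generated by the image of `γ`)] -/
theorem exists_mem_layerSubgroup_mul_pow (hγ : κ.IsTopGenerator γ) (m : ℕ) (σ : Field.absoluteGaloisGroup K) :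
    ∃ h ∈ κ.layerSubgroup m, ∃ e : ℕ, σ = h * γ ^ e := by
  set a : ℤ_[p] := (κ σ).toAdd with ha
  have happr := PadicInt.appr_spec m a
  refine ⟨σ * (γ ^ a.appr m)⁻¹, ?_, a.appr m, by rw [inv_mul_cancel_right]⟩
  rw [ZpExtension.mem_layerSubgroup, map_mul, map_inv, toAdd_mul, toAdd_inv, map_pow,
    show κ γ = Multiplicative.ofAdd 1 from hγ, ← ofAdd_nsmul, toAdd_ofAdd, nsmul_eq_mul, mul_one,
    ← sub_eq_add_neg]
  exact Ideal.mem_span_singleton.mp happr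

omit [NumberField K] [W.IsElliptic] hp in
/-- For an additive endomorphism `T` agreeing with `conj_γ`: `T^m x = conj_{γ^m} x` (`conjH1_one_holds`, `conjH1_mul_holds`). [folklore] -/
theorem end_pow_apply_eq_conjH1_pow (H : Subgroup (Field.absoluteGaloisGroup K)) [H.Normal] (g : Field.absoluteGaloisGroup K)
    (T : AddMonoid.End (W.subgroupH1 p H)) (hT : ∀ x, T x = W.conjH1 p H g x) (m : ℕ) (x : W.subgroupH1 p H) :
    (T ^ m) x = W.conjH1 p H (g ^ m) x := by
  induction m with
  | zero => rw [pow_zero, pow_zero, AddMonoid.End.one_apply, W.conjH1_one_holds p H, AddMonoidHom.id_apply]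
  | succ m ih =>
      rw [pow_succ', AddMonoid.End.coe_mul, Function.comp_apply, ih, hT, pow_succ', W.conjH1_mul_holds p H,
        AddMonoidHom.comp_apply]

omit [NumberField K] [W.IsElliptic] in
/-- `Φ_{p^{k+1}}(T) x = Σ_{i<p} conj_{γ^{p^k i}} x` on `H¹(Gal(K̄/K_{k+1}), E[p^∞])` for `T` agreeing with `conj_γ`
(`Φ_{p^{k+1}}(X) = Σ_{i<p} X^{p^k i}`, Mathlib `cyclotomic_prime_pow_eq_geom_sum`). [folklore] -/
theorem aeval_cyclotomic_apply_eq_sum_conjH1 (k : ℕ) (T : AddMonoid.End (W.subgroupH1 p (κ.layerSubgroup (k + 1))))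
    (hT : ∀ x, T x = W.conjH1 p (κ.layerSubgroup (k + 1)) γ x) (x : W.subgroupH1 p (κ.layerSubgroup (k + 1))) :
    aeval T (cyclotomic (p ^ (k + 1)) ℤ) x =
      ∑ i ∈ Finset.range p, W.conjH1 p (κ.layerSubgroup (k + 1)) (γ ^ (p ^ k * i)) x := by
  rw [cyclotomic_prime_pow_eq_geom_sum hp.out, map_sum, addMonoidEnd_sum_apply]
  refine Finset.sum_congr rfl fun i _ ↦ ?_
  rw [map_pow, map_pow, aeval_X, ← pow_mul, end_pow_apply_eq_conjH1_pow W p _ γ T hT]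

omit [NumberField K] [W.IsElliptic] [CharZero R] in
/-- Every `σ ∈ Γ_K` acts on `H¹(Gal(K̄/K_m), E[p^∞])` as a power of `conj_γ` and a character `χ` of `Γ_K` trivial on
`Gal(K̄/K_m)` takes the value `χ(γ)^e` there: `σ = h γ^e` with `h ∈ Gal(K̄/K_m)` (`exists_mem_layerSubgroup_mul_pow`) and inner
automorphisms act trivially (`conjH1_of_mem_holds`). Washington, §13.1; Serre, *Local Fields*, VII.§5 Prop. 3.
[cite: Washington1997, §13.1 (`Gal(K_n/K) ≃ ℤ/pⁿℤ` generated by `γ`)] -/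
theorem exists_chi_eq_pow_and_conjH1_eq_pow (hγ : κ.IsTopGenerator γ) (m : ℕ) (χ : Field.absoluteGaloisGroup K → R)
    (hmul : ∀ σ τ, χ (σ * τ) = χ σ * χ τ) (hker : ∀ σ ∈ κ.layerSubgroup m, χ σ = 1)
    (T : AddMonoid.End (W.subgroupH1 p (κ.layerSubgroup m))) (hT : ∀ x, T x = W.conjH1 p (κ.layerSubgroup m) γ x)
    (σ : Field.absoluteGaloisGroup K) :
    ∃ e : ℕ, χ σ = χ γ ^ e ∧ ∀ x : W.subgroupH1 p (κ.layerSubgroup m),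
      W.conjH1 p (κ.layerSubgroup m) σ x = (T ^ e) x := by
  obtain ⟨h, hh, e, rfl⟩ := exists_mem_layerSubgroup_mul_pow p κ hγ m σ
  have hχpow : ∀ j : ℕ, χ (γ ^ j) = χ γ ^ j := fun j ↦ by
    induction j with
    | zero => rw [pow_zero, pow_zero]; exact hker 1 (κ.layerSubgroup m).one_mem
    | succ j ih => rw [pow_succ, hmul, ih, pow_succ]
  refine ⟨e, by rw [hmul, hker h hh, one_mul, hχpow], fun x ↦ ?_⟩
  rw [W.conjH1_mul_holds p (κ.layerSubgroup m), AddMonoidHom.comp_apply, end_pow_apply_eq_conjH1_pow W p _ γ T hT,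
    W.conjH1_of_mem_holds p (κ.layerSubgroup m) hh, AddMonoidHom.id_apply]

omit [NumberField K] [W.IsElliptic] in
/-- ★ **The faithful part lies in Kato's `χ`-part: `Σ_{i<p} conj_{γ^{p^k i}} x = 0 → x ∈ chiPart conj χ`** on
`H¹(Gal(K̄/K_{k+1}), E[p^∞])`, for every character `χ : Γ_K → R` (multiplicative, trivial on `Gal(K̄/K_{k+1})`) with `χ(γ)` a
primitive `p^{k+1}`-th root of unity — i.e. every FAITHFUL character of `Gal(K_{k+1}/K) ≅ ℤ/p^{k+1}`. Kato, Astérisque 295,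
p. 235; Washington, Ch. 2 / §13.1. [cite: Kato2004Asterisque, §14 Thm. 14.2 (p. 235)] -/
theorem mem_chiPart_conjH1_of_sum_conjH1_eq_zero (hγ : κ.IsTopGenerator γ) (k : ℕ)
    (χ : Field.absoluteGaloisGroup K → R) (hmul : ∀ σ τ, χ (σ * τ) = χ σ * χ τ)
    (hker : ∀ σ ∈ κ.layerSubgroup (k + 1), χ σ = 1) (hprim : IsPrimitiveRoot (χ γ) (p ^ (k + 1)))
    {x : W.subgroupH1 p (κ.layerSubgroup (k + 1))}
    (hx : ∑ i ∈ Finset.range p, W.conjH1 p (κ.layerSubgroup (k + 1)) (γ ^ (p ^ k * i)) x = 0) :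
    x ∈ chiPart (fun σ ↦ W.conjH1 p (κ.layerSubgroup (k + 1)) σ) χ := by
  let T : AddMonoid.End (W.subgroupH1 p (κ.layerSubgroup (k + 1))) := W.conjH1 p (κ.layerSubgroup (k + 1)) γ
  have hT : ∀ y, T y = W.conjH1 p (κ.layerSubgroup (k + 1)) γ y := fun _ ↦ rfl
  refine mem_chiPart_of_aeval_cyclotomic_apply_eq_zero (fun σ ↦ W.conjH1 p (κ.layerSubgroup (k + 1)) σ) χ γ T
    (pow_pos hp.out.pos _) hprim (exists_chi_eq_pow_and_conjH1_eq_pow W p κ hγ (k + 1) χ hmul hker T hT) ?_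
  rw [aeval_cyclotomic_apply_eq_sum_conjH1 W p κ k T hT x, hx]

omit [NumberField K] [W.IsElliptic] [CharZero R] in
/-- **Converse: Kato's `χ`-part of a faithful `χ` is killed by the norm `Σ_{i<p} conj_{γ^{p^k i}}`.** Kato, Astérisque 295,
p. 235. [cite: Kato2004Asterisque, §14 Thm. 14.2 (p. 235)] -/
theorem sum_conjH1_eq_zero_of_mem_chiPart_conjH1 (k : ℕ)
    (χ : Field.absoluteGaloisGroup K → R) (hmul : ∀ σ τ, χ (σ * τ) = χ σ * χ τ)
    (hker : ∀ σ ∈ κ.layerSubgroup (k + 1), χ σ = 1) (hprim : IsPrimitiveRoot (χ γ) (p ^ (k + 1)))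
    {x : W.subgroupH1 p (κ.layerSubgroup (k + 1))}
    (hx : x ∈ chiPart (fun σ ↦ W.conjH1 p (κ.layerSubgroup (k + 1)) σ) χ) :
    ∑ i ∈ Finset.range p, W.conjH1 p (κ.layerSubgroup (k + 1)) (γ ^ (p ^ k * i)) x = 0 := by
  let T : AddMonoid.End (W.subgroupH1 p (κ.layerSubgroup (k + 1))) := W.conjH1 p (κ.layerSubgroup (k + 1)) γ
  have hT : ∀ y, T y = W.conjH1 p (κ.layerSubgroup (k + 1)) γ y := fun _ ↦ rfl
  have hχpow : ∀ j : ℕ, χ (γ ^ j) = χ γ ^ j := fun j ↦ by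
    induction j with
    | zero => rw [pow_zero, pow_zero]; exact hker 1 (κ.layerSubgroup (k + 1)).one_mem
    | succ j ih => rw [pow_succ, hmul, ih, pow_succ]
  rw [← aeval_cyclotomic_apply_eq_sum_conjH1 W p κ k T hT x]
  exact aeval_cyclotomic_apply_eq_zero_of_mem_chiPart (fun σ ↦ W.conjH1 p (κ.layerSubgroup (k + 1)) σ) χ γ T
    (pow_pos hp.out.pos _) hprim hχpow (fun j y ↦ (end_pow_apply_eq_conjH1_pow W p _ γ T hT j y).symm) hx

omit [NumberField K] [W.IsElliptic] in
/-- ★ **`x ∈ chiPart conj χ ↔ Σ_{i<p} conj_{γ^{p^k i}} x = 0`** for every faithful character `χ` of `Gal(K_{k+1}/K)` — the pen's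
CHECK (RC-765): `M^{(χ)} = ker N_{σ_k}` EXACTLY, the same subgroup for all faithful `χ`. [cite: Kato2004Asterisque, §14 Thm. 14.2 (p. 235)] -/
theorem mem_chiPart_conjH1_iff_sum_conjH1_eq_zero (hγ : κ.IsTopGenerator γ) (k : ℕ)
    (χ : Field.absoluteGaloisGroup K → R) (hmul : ∀ σ τ, χ (σ * τ) = χ σ * χ τ)
    (hker : ∀ σ ∈ κ.layerSubgroup (k + 1), χ σ = 1) (hprim : IsPrimitiveRoot (χ γ) (p ^ (k + 1)))
    (x : W.subgroupH1 p (κ.layerSubgroup (k + 1))) :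
    x ∈ chiPart (fun σ ↦ W.conjH1 p (κ.layerSubgroup (k + 1)) σ) χ ↔
      ∑ i ∈ Finset.range p, W.conjH1 p (κ.layerSubgroup (k + 1)) (γ ^ (p ^ k * i)) x = 0 :=
  ⟨sum_conjH1_eq_zero_of_mem_chiPart_conjH1 W p κ k χ hmul hker hprim,
    mem_chiPart_conjH1_of_sum_conjH1_eq_zero W p κ hγ k χ hmul hker hprim⟩

/-! ## §3 Bounded corank from eventually finite `χ`-parts (Kato Cor. 14.3 (1) shape) -/

/-- ★★ **BOUNDED `ℤ_p`-CORANK OF `Sel_{p^∞}(E/K_n)` FROM EVENTUALLY FINITE FAITHFUL `χ`-PARTS.** If for every `k ≥ k₀` there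
is a character `χ_k : Γ_K → R` (multiplicative, trivial on `Gal(K̄/K_{k+1})`, `χ_k(γ)` a primitive `p^{k+1}`-th root of unity —
a faithful character of `Gal(K_{k+1}/K)`) whose Kato `χ`-part of `Sel_{p^∞}(E/K_{k+1})` is FINITE (the conclusion shape of
Kato's Cor. 14.3 (1), `Finite (chiPart ρ χ ⊓ Sel)`), then `∃ B, ∀ n, zpCorank (W.selmerLayer κ n) p ≤ B` — the binder `hKR` of
`OddBlindNF.classicalNoFiniteSubmodule_goodSS_two_of_casselsTateLayerPairing_of_corankBounded` (★★ p823354).  By §2 and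
`exists_forall_zpCorank_selmerLayer_le_of_eventually_finite_faithfulPart` (★★ p825069).  For `E/ℚ` at good supersingular
`2`: `χ`-parts finite ⟸ Kato Cor. 14.3 (1) (`L(E,χ,1) ≠ 0`, every `p`) and `k₀` ⟸ Rohrlich — NOT used here.
[cite: Kato2004Asterisque, §14 Thm. 14.2 (p. 235)] [cite: GreenbergLNM1716, §1 pp. 54–57] -/
theorem exists_forall_zpCorank_selmerLayer_le_of_eventually_finite_chiPart (hγ : κ.IsTopGenerator γ)
    (hfin : ∃ k₀ : ℕ, ∀ k : ℕ, k₀ ≤ k → ∃ χ : Field.absoluteGaloisGroup K → R,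
      (∀ σ τ, χ (σ * τ) = χ σ * χ τ) ∧ (∀ σ ∈ κ.layerSubgroup (k + 1), χ σ = 1) ∧
      IsPrimitiveRoot (χ γ) (p ^ (k + 1)) ∧
      Finite ↥(chiPart (fun σ ↦ W.conjH1 p (κ.layerSubgroup (k + 1)) σ) χ ⊓ W.selmerLayer κ (k + 1))) :
    ∃ B : ℕ, ∀ n : ℕ, zpCorank (W.selmerLayer κ n) p ≤ B := by
  refine exists_forall_zpCorank_selmerLayer_le_of_eventually_finite_faithfulPart W p κ hγ ?_
  obtain ⟨k₀, hk₀⟩ := hfin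
  refine ⟨k₀, fun k hk ↦ ?_⟩
  obtain ⟨χ, hmul, hker, hprim, hF⟩ := hk₀ k hk
  let C : AddSubgroup (W.subgroupH1 p (κ.layerSubgroup (k + 1))) :=
    chiPart (fun σ ↦ W.conjH1 p (κ.layerSubgroup (k + 1)) σ) χ ⊓ W.selmerLayer κ (k + 1)
  refine ⟨{x | (x : W.subgroupH1 p (κ.layerSubgroup (k + 1))) ∈ C}, ?_, fun x hx ↦ ?_⟩
  · haveI : Finite C := hF
    exact Finite.of_injective
      (fun x : {x : W.selmerLayer κ (k + 1) | (x : W.subgroupH1 p (κ.layerSubgroup (k + 1))) ∈ C} ↦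
        (⟨((x : W.selmerLayer κ (k + 1)) : W.subgroupH1 p (κ.layerSubgroup (k + 1))), x.2⟩ : C))
      fun a b hab ↦ Subtype.ext (Subtype.ext (congrArg (fun z : C ↦ (z : W.subgroupH1 p (κ.layerSubgroup (k + 1)))) hab))
  · exact ⟨mem_chiPart_conjH1_of_sum_conjH1_eq_zero W p κ hγ k χ hmul hker hprim hx, x.2⟩

end Tower

end Summit.BirchSwinnertonDyer.BirchSwinnertonDyer.Theorems.TowerCorank

end
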